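import Summits.QuantumAdvantage.QuantumAdvantage.Theorems.CubicForrelationNearExactIsExactKtGapTwoTools

/-!
# Crux `CubicForrelation.NearExactIsExact` (stmt-QuantumAdvantage-14043) — the SECOND Kasami–Tokura gap of cubics, II: the closure constraint
  (the directions `z` with `|F(z)| = 3·2^k + t`, together with `0`, form a `⊕`-closed set, so their number `C` has `C + 1 = 2^j`)

Certificate seat `b2b-cforr-cert` (gen 18).  HONEST FRAMING: a coding-theory BRICK (standard axioms), uniform in `k`; the NEW ingredient that makes
the moment method work for the second gap `(1.75d, 1.875d)` of `RM(3,m)` (`…KtGapTwoStep.lean`, `…KtGapTwoCubic.lean`).  NOT summit progress.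

`ktg2_closure`.  Let `c` be cubic on `m = k + 5` bits with support `E`, `#E = 7L + t` (`L = 2^k`, `0 < t`, `2t < L`), whose character sums
`F(z) = Σ_E (−1)^{x·z}` off `0` lie in `{±t, ±(L+t), ±(3L+t)}`.  If `|F(z)| = 3L + t` then one side `U = E ∩ {⟨x,z⟩ = b}` of the hyperplane has
exactly `2L = 2^{m−4}` points and is the support of the degree-`≤ 4` function `c·[⟨x,z⟩ = b]` — a minimum-weight word of `RM(4,m)`, hence a FLAT,
whose character sums are `0, ±2L` (`ktg2_minweight_twist_sum`).  Splitting `E` along that side, `F(z ⊕ z') = ±(2·Σ_U(−1)^{x·z'} − F(z'))`; for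
another far direction `z'` this is `±(3L+t)` (when `Σ_U = 0`) or `±(L − t), ±(7L + t)` — both outside the admissible set since `2t < L`.  So the
far directions together with `0` are `⊕`-closed and their number plus one is a power of two (`ktg2_xor_closed_card`).

References: T. Kasami, N. Tokura, IEEE Trans. IT 16 (1970) 752–759; MacWilliams–Sloane (1977) Ch. 13 §4, Ch. 15 §3; O'Donnell (2014) §3.3.
Axioms: standard.
-/

set_option linter.dupNamespace false -- D-0017: single-problem summit ⇒ `QuantumAdvantage.QuantumAdvantage` by design

noncomputable section

namespace Summit.QuantumAdvantage.QuantumAdvantage.Theorems.CubicForrelation.NearExactIsExact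

open Finset
open Literature.Computability.QuantumComplexity
open Literature.Computability.QuantumComplexity.BuzetChailloux (bxor zeroVec bxor_bxor_cancel_left bxor_zeroVec zeroVec_bxor bxor_comm
  bxor_self twist_zeroVec_right twist_bxor_right)
open Literature.Computability.QuantumComplexity.DerivativeWalsh (W twist_bxor_left)
open Literature.Computability.QuantumComplexity.Simon (twist_eq_one_or)
open Summit.QuantumAdvantage.QuantumAdvantage.Theorems.SignedCubicForrelationNotPrBPP (knf_isDegLeFun_ip)


/-! ### The closure constraint: the directions with `|F| = 3L + t`, together with `0`, are `⊕`-closed -/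

/-- **Closure of the far directions.**  For a cubic `c` on `k + 5` bits with `#{c = 1} = 7·2^k + t`, `0 < t`, `2t < 2^k`, whose character sums
off `0` lie in `{±t, ±(2^k + t), ±(3·2^k + t)}`: the directions `z ≠ 0` with `F(z)² = (3·2^k + t)²` together with `0` form a `⊕`-closed set, so
their number `C` has `C + 1 = 2^j`.  (On such a `z` one side of the hyperplane carries exactly `2·2^k = 2^{m−4}` points of the support — a
minimum-weight word of `RM(4,m)`, a flat `U` with character sums `0, ±2·2^k`; and `F(z ⊕ z') = ±(2 Σ_U (−1)^{x·z'} − F(z'))`.) [this work] -/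
theorem ktg2_closure (k : ℕ) (c : (Fin (k + 4 + 1) → Bool) → Bool) (hc : IsDegLeFun 3 c) (t : ℕ)
    (hwt : #(univ.filter fun x => c x = true) = 7 * 2 ^ k + t) (ht0 : 0 < t) (h2t : 2 * t < 2 ^ k)
    (F : (Fin (k + 4 + 1) → Bool) → ℝ) (hF : ∀ z, F z = ∑ x ∈ univ.filter (fun x => c x = true), twist x z)
    (hFval : ∀ z, z ≠ zeroVec → F z = t ∨ F z = (2 : ℝ) ^ k + t ∨ F z = 3 * (2 : ℝ) ^ k + t ∨ F z = -(t : ℝ) ∨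
      F z = -((2 : ℝ) ^ k + t) ∨ F z = -(3 * (2 : ℝ) ^ k + t)) :
    ∃ j, #(univ.filter fun z : Fin (k + 4 + 1) → Bool => z ≠ zeroVec ∧ F z ^ 2 = (3 * (2 : ℝ) ^ k + t) ^ 2) + 1 = 2 ^ j := by
  classical
  set S := univ.filter (fun x : Fin (k + 4 + 1) → Bool => c x = true) with hSdef
  have hN : (2 : ℕ) ^ (k + 4 + 1) = 32 * 2 ^ k := by ring
  set L : ℝ := (2 : ℝ) ^ k with hLdef
  have hLposR : (0 : ℝ) < L := by positivity
  have htR : (0 : ℝ) < (t : ℝ) := by exact_mod_cast ht0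
  have h2tR : 2 * (t : ℝ) < L := by rw [hLdef]; exact_mod_cast h2t
  have hw : ((#S : ℕ) : ℝ) = 7 * L + t := by rw [hwt]; push_cast; rw [hLdef]
  have hF0 : F zeroVec = #S := by
    rw [hF]
    rw [sum_congr rfl fun x _ => twist_zeroVec_right x, sum_const]; norm_num
  set ℓ : (Fin (k + 4 + 1) → Bool) → (Fin (k + 4 + 1) → Bool) → Bool :=
    fun z x => decide (Odd #(univ.filter fun i => (x i && z i) = true)) with hℓdef
  have htwℓ : ∀ x z, twist x z = signOf (ℓ z x) := fun x z => vg_twist_eq_signOf x z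
  have hFz : ∀ z, F z = #S - 2 * (#(univ.filter fun x => c x = true ∧ ℓ z x = true) : ℝ) := fun z => by
    rw [hF]; exact ktg_F_half c z
  have hFsq : ∀ z, z ≠ zeroVec → F z ^ 2 = (t : ℝ) ^ 2 ∨ F z ^ 2 = (L + t) ^ 2 ∨ F z ^ 2 = (3 * L + t) ^ 2 := by
    intro z hz
    rcases hFval z hz with h | h | h | h | h | h <;> rw [h]
    · exact Or.inl rfl
    · exact Or.inr (Or.inl rfl)
    · exact Or.inr (Or.inr rfl)
    · exact Or.inl (by ring)
    · exact Or.inr (Or.inl (by ring))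
    · exact Or.inr (Or.inr (by ring))
  -- for a direction with `|F| = 3L + t`: a side `b` with exactly `2L` points
  have hside : ∀ z, z ≠ zeroVec → F z ^ 2 = (3 * L + t) ^ 2 →
      ∃ b : Bool, #(univ.filter fun x => c x = true ∧ ℓ z x = b) = 2 * 2 ^ k := by
    intro z _ hsq
    have hT := hFz z
    have haddz := ktg_half_add c z
    change #(univ.filter fun x => c x = true ∧ ℓ z x = true) + #(univ.filter fun x => c x = true ∧ ℓ z x = false) = _ at haddz
    rw [← hSdef] at haddz
    rcases sq_eq_sq_iff_eq_or_eq_neg.1 hsq with h | h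
    · refine ⟨true, ?_⟩
      have e : ((#(univ.filter fun x => c x = true ∧ ℓ z x = true) : ℕ) : ℝ) = ((2 * 2 ^ k : ℕ) : ℝ) := by
        push_cast; rw [← hLdef]; linarith [hw]
      exact_mod_cast e
    · refine ⟨false, ?_⟩
      have e : ((#(univ.filter fun x => c x = true ∧ ℓ z x = true) : ℕ) : ℝ) = ((#S - 2 * 2 ^ k : ℕ) : ℝ) := by
        rw [Nat.cast_sub (by omega)]; push_cast; rw [← hLdef]; linarith [hw]
      have e' : #(univ.filter fun x => c x = true ∧ ℓ z x = true) = #S - 2 * 2 ^ k := by exact_mod_cast e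
      omega
  -- character sums of such a side are `0, ±2L`
  have hG : ∀ z (b : Bool), #(univ.filter fun x => c x = true ∧ ℓ z x = b) = 2 * 2 ^ k → ∀ y,
      (∑ x ∈ univ.filter (fun x => c x = true ∧ ℓ z x = b), twist x y) = 0 ∨
      (∑ x ∈ univ.filter (fun x => c x = true ∧ ℓ z x = b), twist x y) = 2 * L ∨
      (∑ x ∈ univ.filter (fun x => c x = true ∧ ℓ z x = b), twist x y) = -(2 * L) := by
    intro z b hcard y
    set e : (Fin (k + 4 + 1) → Bool) → Bool := fun x => c x && (ℓ z x ^^ !b) with hedef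
    have he : IsDegLeFun (3 + 1) e := te_isDegLeFun_band hc (tb_isDegLeFun_xor_const (knf_isDegLeFun_ip z) (!b))
    have hset : (univ.filter fun x => e x = true) = univ.filter fun x => c x = true ∧ ℓ z x = b := by
      apply filter_congr
      intro x _
      simp only [e]
      cases c x <;> cases ℓ z x <;> cases b <;> simp
    have hS' : 2 ^ (3 + 1) * #(univ.filter fun x => e x = true) = 2 ^ (k + 4 + 1) := by rw [hset, hcard, hN]; ring
    have h := ktg2_minweight_twist_sum e he hS' y
    rw [hset, hcard] at h
    push_cast at h
    rw [hLdef]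
    exact h
  -- splitting `F(z ⊕ z')` along the side
  have hsplit : ∀ z z' (b : Bool), F (bxor z z') =
      signOf b * (2 * (∑ x ∈ univ.filter (fun x => c x = true ∧ ℓ z x = b), twist x z') - F z') := by
    intro z z' b
    have hU : (univ.filter fun x => c x = true ∧ ℓ z x = b) = S.filter (fun x => ℓ z x = b) := by
      ext x; simp only [hSdef, mem_filter, mem_univ, true_and]
    rw [hF, hF, hU, ← sum_filter_add_sum_filter_not S (fun x => ℓ z x = b) (fun x => twist x (bxor z z')),
      ← sum_filter_add_sum_filter_not S (fun x => ℓ z x = b) (fun x => twist x z')]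
    have e1 : ∑ x ∈ S.filter (fun x => ℓ z x = b), twist x (bxor z z') = signOf b * ∑ x ∈ S.filter (fun x => ℓ z x = b), twist x z' := by
      rw [mul_sum]
      refine sum_congr rfl fun x hx => ?_
      rw [twist_bxor_right, htwℓ x z, (mem_filter.1 hx).2]
    have e2 : ∑ x ∈ S.filter (fun x => ¬ ℓ z x = b), twist x (bxor z z') =
        -signOf b * ∑ x ∈ S.filter (fun x => ¬ ℓ z x = b), twist x z' := by
      rw [mul_sum]
      refine sum_congr rfl fun x hx => ?_
      have hx' : ℓ z x = !b := by have := (mem_filter.1 hx).2; revert this; cases ℓ z x <;> cases b <;> simp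
      rw [twist_bxor_right, htwℓ x z, hx']
      cases b <;> simp [signOf]
    rw [e1, e2]
    ring
  have hsb : ∀ b : Bool, (signOf b : ℝ) ^ 2 = 1 := fun b => by cases b <;> simp [signOf]
  have hclos : ∀ z₁ z₂, z₁ ≠ zeroVec → z₁ ≠ z₂ → F z₁ ^ 2 = (3 * L + t) ^ 2 → F z₂ ^ 2 = (3 * L + t) ^ 2 →
      F (bxor z₁ z₂) ^ 2 = (3 * L + t) ^ 2 := by
    intro z₁ z₂ hz₁ hne hsq₁ hsq₂
    have hz₃ : bxor z₁ z₂ ≠ zeroVec := by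
      intro h
      apply hne
      funext i
      have := congrFun h i
      change (z₁ i ^^ z₂ i) = false at this
      revert this; cases z₁ i <;> cases z₂ i <;> simp
    obtain ⟨b, hb⟩ := hside z₁ hz₁ hsq₁
    have hsp := hsplit z₁ z₂ b
    have h3 := hFsq (bxor z₁ z₂) hz₃
    rcases hG z₁ b hb z₂ with hg | hg | hg
    · rw [hsp, hg, mul_pow, hsb]; linear_combination hsq₂
    · exfalso
      rw [hsp, hg, mul_pow, hsb, one_mul] at h3
      rcases sq_eq_sq_iff_eq_or_eq_neg.1 hsq₂ with h | h <;> rw [h] at h3 <;> rcases h3 with h3 | h3 | h3 <;>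
        rcases sq_eq_sq_iff_eq_or_eq_neg.1 h3 with h4 | h4 <;> linarith
    · exfalso
      rw [hsp, hg, mul_pow, hsb, one_mul] at h3
      rcases sq_eq_sq_iff_eq_or_eq_neg.1 hsq₂ with h | h <;> rw [h] at h3 <;> rcases h3 with h3 | h3 | h3 <;>
        rcases sq_eq_sq_iff_eq_or_eq_neg.1 h3 with h4 | h4 <;> linarith
  set T := univ.filter (fun z : Fin (k + 4 + 1) → Bool => z = zeroVec ∨ F z ^ 2 = (3 * L + t) ^ 2) with hTdef
  have hmemT : ∀ z, z ∈ T ↔ z = zeroVec ∨ F z ^ 2 = (3 * L + t) ^ 2 := fun z => by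
    rw [hTdef, mem_filter]; exact ⟨fun h => h.2, fun h => ⟨mem_univ _, h⟩⟩
  have hT0 : zeroVec ∈ T := (hmemT _).2 (Or.inl rfl)
  have hTadd : ∀ a ∈ T, ∀ b ∈ T, bxor a b ∈ T := by
    intro a ha b hb
    rcases (hmemT a).1 ha with ha' | ha'
    · rw [ha', zeroVec_bxor]; exact hb
    rcases (hmemT b).1 hb with hb' | hb'
    · rw [hb', bxor_zeroVec]; exact ha
    by_cases hab : a = b
    · rw [hab, bxor_self]; exact hT0
    have ha0 : a ≠ zeroVec := by
      intro h; rw [h, hF0] at ha'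
      rcases sq_eq_sq_iff_eq_or_eq_neg.1 ha' with h' | h' <;> linarith [hw]
    exact (hmemT _).2 (Or.inr (hclos a b ha0 hab ha' hb'))
  obtain ⟨j, hj⟩ := ktg2_xor_closed_card T hT0 hTadd
  have hTC : #T = #(univ.filter fun z : Fin (k + 4 + 1) → Bool => z ≠ zeroVec ∧ F z ^ 2 = (3 * L + t) ^ 2) + 1 := by
    have e : T = insert zeroVec (univ.filter fun z : Fin (k + 4 + 1) → Bool => z ≠ zeroVec ∧ F z ^ 2 = (3 * L + t) ^ 2) := by
      ext z
      rw [hmemT, mem_insert, mem_filter]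
      constructor
      · rintro (h | h)
        · exact Or.inl h
        · by_cases hz : z = zeroVec
          · exact Or.inl hz
          · exact Or.inr ⟨mem_univ _, hz, h⟩
      · rintro (h | ⟨-, -, h⟩)
        · exact Or.inl h
        · exact Or.inr h
    rw [e, card_insert_of_notMem (by simp)]
  exact ⟨j, by rw [← hTC, hj]⟩

end Summit.QuantumAdvantage.QuantumAdvantage.Theorems.CubicForrelation.NearExactIsExact

end
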